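import Summits.KontsevichZagierPeriods.KontsevichZagierPeriods.Theorems.ValuedFieldSpecialisationClassLevelExpansionFibreDimOneDirTaylor

/-!
# Route ValuedFieldSpecialisation — two-sided uniform Taylor bounds along a coordinate

Helper for item stmt-KontsevichZagierPeriods-3503 (`ClassLevelExpansionFibreDimOne`). The uniform
Taylor bound `exists_taylor_bound_slice` (`…DirTaylor`) controls `G(t, x)` for `0 ≤ t ≤ δ₀`; here it
is extended to `|t| ≤ δ₀` (`exists_taylor_bound_slice_symm`) by applying it to `G` composed with the
reflection `t ↦ −t` of the expansion coordinate, whose iterated directional derivatives are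
`(−1)^k` times those of `G` (`iterate_dirDeriv_comp_reflect₀`).

Source: folklore (Taylor's formula).
-/

noncomputable section

namespace Summit.KontsevichZagierPeriods.ValuedFieldSpecialisation

open Set Filter Function
open scoped Topology

variable {m : ℕ}

/-- The reflection of the coordinate `0` as a continuous linear map. [folklore] -/
theorem reflect₀CLM_apply (z : Fin (m + 1) → ℝ) :
    (ContinuousLinearMap.pi (Fin.cases (motive := fun _ => (Fin (m + 1) → ℝ) →L[ℝ] ℝ)
        (-(ContinuousLinearMap.proj (R := ℝ) (0 : Fin (m + 1))))
        (fun i => ContinuousLinearMap.proj (R := ℝ) i.succ)) :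
      (Fin (m + 1) → ℝ) →L[ℝ] (Fin (m + 1) → ℝ)) z =
      Matrix.vecCons (-z 0) (fun i : Fin m => z i.succ) := by
  ext j
  refine Fin.cases ?_ (fun i => ?_) j
  · simp
  · simp

/-- The reflection of the coordinate `0` is an involution. [folklore] -/
theorem reflect₀_reflect₀ (z : Fin (m + 1) → ℝ) :
    (Matrix.vecCons (-(Matrix.vecCons (-z 0) (fun i : Fin m => z i.succ) : Fin (m + 1) → ℝ) 0)
      (fun i : Fin m => (Matrix.vecCons (-z 0) (fun i : Fin m => z i.succ) : Fin (m + 1) → ℝ) i.succ) :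
        Fin (m + 1) → ℝ) = z := by
  ext j
  refine Fin.cases ?_ (fun i => ?_) j
  · simp
  · simp

/-- **Iterated directional derivatives of a reflected function.** For `G` analytic on an open set
`O`, the `k`-th directional derivative along `e₀` of `z ↦ G(−z₀, z')` at `z` with `(−z₀, z') ∈ O` is
`(−1)^k (∂₀ᵏ G)(−z₀, z')`. [folklore] -/
theorem iterate_dirDeriv_comp_reflect₀ {O : Set (Fin (m + 1) → ℝ)} (hO : IsOpen O)
    {G : (Fin (m + 1) → ℝ) → ℝ} (hG : AnalyticOnNhd ℝ G O) (k : ℕ) :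
    ∀ z : Fin (m + 1) → ℝ, (Matrix.vecCons (-z 0) (fun i : Fin m => z i.succ) : Fin (m + 1) → ℝ) ∈ O →
      ((fun f : (Fin (m + 1) → ℝ) → ℝ => fun z => fderiv ℝ f z (Pi.single 0 1))^[k]
          (fun z => G (Matrix.vecCons (-z 0) (fun i : Fin m => z i.succ)))) z =
        (-1) ^ k * ((fun f : (Fin (m + 1) → ℝ) → ℝ => fun z => fderiv ℝ f z (Pi.single 0 1))^[k] G)
          (Matrix.vecCons (-z 0) (fun i : Fin m => z i.succ)) := by
  set Rc : (Fin (m + 1) → ℝ) →L[ℝ] (Fin (m + 1) → ℝ) :=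
    ContinuousLinearMap.pi (Fin.cases (motive := fun _ => (Fin (m + 1) → ℝ) →L[ℝ] ℝ)
      (-(ContinuousLinearMap.proj (R := ℝ) (0 : Fin (m + 1)))) (fun i => ContinuousLinearMap.proj (R := ℝ) i.succ))
    with hRc
  have hRc_apply : ∀ z, Rc z = Matrix.vecCons (-z 0) (fun i : Fin m => z i.succ) := fun z => reflect₀CLM_apply z
  have hRe : Rc (Pi.single 0 1) = -(Pi.single 0 1 : Fin (m + 1) → ℝ) := by
    rw [hRc_apply]
    ext j
    refine Fin.cases ?_ (fun i => ?_) j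
    · simp
    · simp [Fin.succ_ne_zero]
  -- the preimage `O' = Rc ⁻¹' O` is open
  have hO'o : IsOpen (Rc ⁻¹' O) := hO.preimage Rc.continuous
  set D : ((Fin (m + 1) → ℝ) → ℝ) → (Fin (m + 1) → ℝ) → ℝ :=
    fun f => fun z => fderiv ℝ f z (Pi.single 0 1) with hD
  -- induction on `k`, for all points of `O'`
  suffices h : ∀ k : ℕ, ∀ z ∈ Rc ⁻¹' O, (D^[k] (fun z => G (Rc z))) z = (-1) ^ k * (D^[k] G) (Rc z) by
    intro z hz
    have hz' : z ∈ Rc ⁻¹' O := by show Rc z ∈ O; rw [hRc_apply]; exact hz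
    have hfun : (fun z => G (Rc z)) = fun z => G (Matrix.vecCons (-z 0) (fun i : Fin m => z i.succ)) :=
      funext fun z => by rw [hRc_apply]
    have := h k z hz'
    rw [hfun, hRc_apply] at this
    exact this
  intro k
  induction k with
  | zero => intro z _; simp
  | succ k ih =>
    intro z hz
    rw [iterate_succ', comp_apply, comp_apply]
    show fderiv ℝ (D^[k] (fun z => G (Rc z))) z (Pi.single 0 1) = (-1) ^ (k + 1) * fderiv ℝ (D^[k] G) (Rc z) (Pi.single 0 1)
    -- on the open set `O'`, `D^[k] (G ∘ Rc)` agrees with `(-1)^k • (D^[k] G) ∘ Rc`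
    have hev : (D^[k] (fun z => G (Rc z))) =ᶠ[𝓝 z] fun z => (-1) ^ k * (D^[k] G) (Rc z) :=
      Filter.eventually_of_mem (hO'o.mem_nhds hz) fun w hw => ih w hw
    rw [hev.fderiv_eq]
    have hdiff : DifferentiableAt ℝ (D^[k] G) (Rc z) := (analyticOnNhd_iterate_dirDeriv hG k _ hz).differentiableAt
    have hcomp : HasFDerivAt (fun z => (D^[k] G) (Rc z)) ((fderiv ℝ (D^[k] G) (Rc z)).comp Rc) z :=
      hdiff.hasFDerivAt.comp z Rc.hasFDerivAt
    rw [((hcomp).const_mul ((-1 : ℝ) ^ k)).fderiv]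
    simp only [FunLike.coe_smul, Pi.smul_apply, ContinuousLinearMap.coe_comp, comp_apply, hRe,
      map_neg, smul_eq_mul, pow_succ]
    ring

/-- **Two-sided uniform Taylor bound along the coordinate `0`.** With the data of
`exists_taylor_bound_slice` but a tube `[−δ₀, δ₀] × P ⊆ O`, the Taylor remainder of order `K` is
bounded by `C |t|^{K+1}` for `|t| ≤ δ₀`. [folklore] -/
theorem exists_taylor_bound_slice_symm {O : Set (Fin (m + 1) → ℝ)} {G : (Fin (m + 1) → ℝ) → ℝ}
    (hO : IsOpen O) (hG : AnalyticOnNhd ℝ G O) {P : Set (Fin m → ℝ)} (hP : IsCompact P)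
    {δ₀ : ℝ} (hδ₀ : 0 < δ₀)
    (hsub : ∀ t ∈ Icc (-δ₀) δ₀, ∀ x ∈ P, (Matrix.vecCons t x : Fin (m + 1) → ℝ) ∈ O) (K : ℕ) :
    ∃ C : ℝ, ∀ x ∈ P, ∀ t ∈ Icc (-δ₀) δ₀,
      |G (Matrix.vecCons t x) - ∑ k ∈ Finset.range (K + 1), ((k.factorial : ℝ)⁻¹ * t ^ k) *
        ((fun f : (Fin (m + 1) → ℝ) → ℝ => fun z => fderiv ℝ f z (Pi.single 0 1))^[k] G)
          (Matrix.vecCons 0 x)| ≤ C * |t| ^ (K + 1) := by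
  -- the bound for `t ≥ 0`
  obtain ⟨C₁, hC₁⟩ := exists_taylor_bound_slice hO hG hP hδ₀ (fun t ht x hx => hsub t ⟨by linarith [ht.1], ht.2⟩ x hx) K
  -- the reflected function
  set Gm : (Fin (m + 1) → ℝ) → ℝ := fun z => G (Matrix.vecCons (-z 0) (fun i : Fin m => z i.succ)) with hGm
  set Om : Set (Fin (m + 1) → ℝ) := {z | (Matrix.vecCons (-z 0) (fun i : Fin m => z i.succ) : Fin (m + 1) → ℝ) ∈ O}
    with hOm
  have hRcont : Continuous fun z : Fin (m + 1) → ℝ => (Matrix.vecCons (-z 0) (fun i : Fin m => z i.succ) : Fin (m + 1) → ℝ) := by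
    refine continuous_pi fun j => ?_
    refine Fin.cases ?_ (fun i => ?_) j
    · exact (continuous_apply 0).neg
    · simpa using continuous_apply i.succ
  have hOmo : IsOpen Om := hO.preimage hRcont
  have hRan : ∀ z, AnalyticAt ℝ (fun z : Fin (m + 1) → ℝ =>
      (Matrix.vecCons (-z 0) (fun i : Fin m => z i.succ) : Fin (m + 1) → ℝ)) z := fun z => by
    have := (ContinuousLinearMap.pi (Fin.cases (motive := fun _ => (Fin (m + 1) → ℝ) →L[ℝ] ℝ)
        (-(ContinuousLinearMap.proj (R := ℝ) (0 : Fin (m + 1)))) (fun i => ContinuousLinearMap.proj (R := ℝ) i.succ)) :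
      (Fin (m + 1) → ℝ) →L[ℝ] (Fin (m + 1) → ℝ)).analyticAt z
    refine this.congr (Filter.Eventually.of_forall fun w => ?_)
    exact reflect₀CLM_apply w
  have hGm_an : AnalyticOnNhd ℝ Gm Om := fun z hz => (hG _ hz).comp_of_eq (hRan z) rfl
  have hsubm : ∀ t ∈ Icc (0 : ℝ) δ₀, ∀ x ∈ P, (Matrix.vecCons t x : Fin (m + 1) → ℝ) ∈ Om := by
    intro t ht x hx
    show (Matrix.vecCons (-(Matrix.vecCons t x : Fin (m + 1) → ℝ) 0)
      (fun i : Fin m => (Matrix.vecCons t x : Fin (m + 1) → ℝ) i.succ) : Fin (m + 1) → ℝ) ∈ O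
    have : (Matrix.vecCons (-(Matrix.vecCons t x : Fin (m + 1) → ℝ) 0)
        (fun i : Fin m => (Matrix.vecCons t x : Fin (m + 1) → ℝ) i.succ) : Fin (m + 1) → ℝ) = Matrix.vecCons (-t) x := by
      ext j; refine Fin.cases ?_ (fun i => ?_) j <;> simp
    rw [this]
    exact hsub (-t) ⟨by linarith [ht.2], by linarith [ht.1]⟩ x hx
  obtain ⟨C₂, hC₂⟩ := exists_taylor_bound_slice hOmo hGm_an hP hδ₀ hsubm K
  -- the derivatives of `Gm` on the slice
  have hder : ∀ x ∈ P, ∀ k : ℕ,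
      ((fun f : (Fin (m + 1) → ℝ) → ℝ => fun z => fderiv ℝ f z (Pi.single 0 1))^[k] Gm) (Matrix.vecCons 0 x) =
        (-1) ^ k * ((fun f : (Fin (m + 1) → ℝ) → ℝ => fun z => fderiv ℝ f z (Pi.single 0 1))^[k] G)
          (Matrix.vecCons 0 x) := by
    intro x hx k
    have h0 : (Matrix.vecCons (-(Matrix.vecCons 0 x : Fin (m + 1) → ℝ) 0)
        (fun i : Fin m => (Matrix.vecCons 0 x : Fin (m + 1) → ℝ) i.succ) : Fin (m + 1) → ℝ) = Matrix.vecCons 0 x := by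
      ext j; refine Fin.cases ?_ (fun i => ?_) j <;> simp
    have := iterate_dirDeriv_comp_reflect₀ hO hG k (Matrix.vecCons 0 x) (by rw [h0]; exact hsub 0 ⟨by linarith, hδ₀.le⟩ x hx)
    rw [h0] at this
    exact this
  refine ⟨max C₁ C₂, fun x hx t ht => ?_⟩
  rcases le_or_gt 0 t with h0t | ht0
  · rw [abs_of_nonneg h0t]
    exact (hC₁ x hx t ⟨h0t, ht.2⟩).trans (mul_le_mul_of_nonneg_right (le_max_left _ _) (pow_nonneg h0t _))
  · -- `t < 0`: use `Gm` at `-t`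
    have hmt : -t ∈ Icc (0 : ℝ) δ₀ := ⟨by linarith, by linarith [ht.1]⟩
    have h := hC₂ x hx (-t) hmt
    have hGmt : Gm (Matrix.vecCons (-t) x) = G (Matrix.vecCons t x) := by
      show G _ = G _
      congr 1
      ext j; refine Fin.cases ?_ (fun i => ?_) j <;> simp
    rw [hGmt] at h
    have hsum : ∑ k ∈ Finset.range (K + 1), ((k.factorial : ℝ)⁻¹ * (-t) ^ k) *
        ((fun f : (Fin (m + 1) → ℝ) → ℝ => fun z => fderiv ℝ f z (Pi.single 0 1))^[k] Gm) (Matrix.vecCons 0 x) =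
        ∑ k ∈ Finset.range (K + 1), ((k.factorial : ℝ)⁻¹ * t ^ k) *
        ((fun f : (Fin (m + 1) → ℝ) → ℝ => fun z => fderiv ℝ f z (Pi.single 0 1))^[k] G) (Matrix.vecCons 0 x) := by
      refine Finset.sum_congr rfl fun k _ => ?_
      rw [hder x hx k, neg_pow t k]
      have h1 : ((-1 : ℝ) ^ k) * ((-1 : ℝ) ^ k) = 1 := by rw [← mul_pow]; norm_num
      linear_combination ((k.factorial : ℝ)⁻¹ * t ^ k *
        ((fun f : (Fin (m + 1) → ℝ) → ℝ => fun z => fderiv ℝ f z (Pi.single 0 1))^[k] G) (Matrix.vecCons 0 x)) * h1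
    rw [hsum] at h
    rw [abs_of_neg ht0]
    exact h.trans (mul_le_mul_of_nonneg_right (le_max_right _ _) (pow_nonneg hmt.1 _))

end Summit.KontsevichZagierPeriods.ValuedFieldSpecialisation
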